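import Summits.BirchSwinnertonDyer.BirchSwinnertonDyer.Theorems.PrintCf2SplitBadTwoLayerNormCharIdeal
import Literature.NumberTheory.EllipticCurves.IwasawaAlgebraUnitTwist
import Literature.NumberTheory.EllipticCurves.IntSeriesIdentityPrinciple
import Summits.BirchSwinnertonDyer.BirchSwinnertonDyer.Theorems.CongruentShaFreeCutPadicSupplyRate
import HarnessLib

/-!
# Values of `Q((1+T)^N − 1)` on the open disc; the unit twist `γ ↦ uγ` FIXES `Λ(Γ^{pⁿ})` when
# `u^{pⁿ} = 1`; at `p = 2` the twist by `u = −1` is `T ↦ −2 − T` in coordinates over `Λ(Γ²)`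

Cell `bsd-print-cf2`, EXTRA WIDTH seat `bsd-line-cf2-p1-w3` g6, planner brick **B10** (RULING (af)(3)),
file 3a, for crux `PrintCf2.SplitBadTwoRankOneOfFacts` (stmt-BirchSwinnertonDyer-20368). THEOREMS ONLY (no
`def`, no named fact, no `sorry`); Theses-free; pure `p`-adic analysis / algebra of `Λ = ℤ_p⟦T⟧` and
`𝒪_{ℂ_p}⟦T⟧`; `--supports` the crux as a helper. BSD is not proved by any of this; no summit statement here.

* §1 `hasValueAt_subst_one_add_X_pow_sub_one_iff` — **evaluation commutes with the
  substitution `T ↦ (1+T)^N − 1`**: for `Q ∈ 𝒪_{ℂ_p}⟦T⟧` and `‖x‖ < 1`, `Q((1+T)^N − 1)` has value `v` at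
  `x` iff `Q` has value `v` at `(1+x)^N − 1` (absolutely convergent double family, summed fibrewise twice —
  the pattern of the tree's `IntSeries.hasValueAt_unitTwist_iff`). This is the reading of `layerHom p n`
  (`T ↦ ω_n`, file 1 `map_layerHom_eq_subst_map`) and of the habitat line's `G((1+T)ⁿ − 1)` at points.
* §2 `unitTwist_layerHom_of_pow_eq_one` — for `u ∈ 1 + pℤ_p` with **`u^{pⁿ} = 1`**, the unit twist
  `ι_u : T ↦ u(1+T) − 1` of B1 (-w5, `PadicIntSeries.unitTwist`) FIXES `Λ_n = ℤ_p⟦ω_n⟧` pointwise: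
  `ι_u(a(ω_n)) = a(ω_n)` (`(u(1+x))^{pⁿ} = (1+x)^{pⁿ}`; identity principle on the open disc of `ℂ_p`,
  tree `IntSeries.eq_of_forall_hasValueAt`). At `p = 2`, `u = −1`, `n ≥ 1`.
* §3 (`p = 2`, index `2`) `unitTwist_neg_one_layerHom_two`, `unitTwist_neg_one_of_coords`:
  `ι₋₁(a(ω_1) + b(ω_1)T) = a(ω_1) − (2+T) b(ω_1)` — so file 2's `f♭` IS `ι₋₁ f = f(−2−T)` and
  `N_1(f)(ω_1) = f · ι₋₁ f` (the assembly with file 2, `PrintCf2SplitBadTwoLayerNormFirstLayerTwo`, is the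
  sequel file); `eq_padicIntToComplexInt_of_coe` (§1): the «structure-compatible `J`» of the tree's
  main-conjecture statements IS `IntSeries.padicIntToComplexInt`.

References: L. C. Washington, *Introduction to Cyclotomic Fields*, GTM 83, §13.2 [Washington1997];
E. de Shalit, *Iwasawa theory of elliptic curves with CM* (1987), II.4.17 (52) (p. 77) [deShalit1987];
N. Koblitz, *p-adic Numbers, p-adic Analysis, and Zeta-Functions*, Ch. IV §1 [Koblitz1984].
-/

noncomputable section

set_option linter.dupNamespace false -- D-0017: single-problem summit, `…BirchSwinnertonDyer.BirchSwinnertonDyer…` repeats a namespace by design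

open PowerSeries Literature.NumberTheory.EllipticCurves
  Summit.BirchSwinnertonDyer.Rank1Residual.X1.LayerAlgebra

/-! ## §1. Values of `Q((1+T)^N − 1)` on the open unit disc of `ℂ_p` -/

namespace Summit.BirchSwinnertonDyer.BirchSwinnertonDyer.Theorems.PrintCf2.LayerNormCharIdeal

open Literature.NumberTheory.EllipticCurves.IntSeries

section Values

variable {p : ℕ} [Fact p.Prime]

/-- The coefficients of `((1+T)^N − 1)^d`, read at `x`, sum to `((1+x)^N − 1)^d` (a polynomial: finite
sum = `eval₂`). [cite: Koblitz1984, Ch. IV §1] -/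
theorem hasSum_coeff_one_add_X_pow_sub_one_pow_mul_pow (N d : ℕ) (x : ℂ_[p]) :
    HasSum (fun k : ℕ => ((PowerSeries.coeff k ((((1 : PowerSeries (PadicComplexInt p)) + X) ^ N - 1) ^ d) :
        PadicComplexInt p) : ℂ_[p]) * x ^ k) (((1 + x) ^ N - 1) ^ d) := by
  set P : Polynomial (PadicComplexInt p) := ((1 + Polynomial.X) ^ N - 1) ^ d with hP
  have hcoe : (((1 : PowerSeries (PadicComplexInt p)) + X) ^ N - 1) ^ d = (P : PowerSeries (PadicComplexInt p)) := by
    rw [hP, Polynomial.coe_pow, Summit.BirchSwinnertonDyer.Rank1Residual.Additive.coe_one_add_X_pow_sub_one]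
  have hfin : ∀ k ∉ Finset.range (P.natDegree + 1),
      ((PowerSeries.coeff k (P : PowerSeries (PadicComplexInt p)) : PadicComplexInt p) : ℂ_[p]) * x ^ k = 0 := by
    intro k hk
    rw [Finset.mem_range, not_lt] at hk
    rw [Polynomial.coeff_coe, Polynomial.coeff_eq_zero_of_natDegree_lt (Nat.lt_of_succ_le hk)]
    simp
  have key : ∑ k ∈ Finset.range (P.natDegree + 1),
      ((PowerSeries.coeff k (P : PowerSeries (PadicComplexInt p)) : PadicComplexInt p) : ℂ_[p]) * x ^ k =
        P.eval₂ (SubringClass.subtype (PadicComplexInt p)) x := by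
    rw [Polynomial.eval₂_eq_sum_range]
    refine Finset.sum_congr rfl fun k _ => ?_
    rw [Polynomial.coeff_coe, SubringClass.coe_subtype]
  have hev : P.eval₂ (SubringClass.subtype (PadicComplexInt p)) x = ((1 + x) ^ N - 1) ^ d := by
    simp only [hP, Polynomial.eval₂_pow, Polynomial.eval₂_sub, Polynomial.eval₂_add, Polynomial.eval₂_one,
      Polynomial.eval₂_X]
  rw [hcoe, ← hev, ← key]
  exact hasSum_sum_of_ne_finset_zero hfin

/-- The terms `[T^d]Q · [T^k]((1+T)^N − 1)^d · x^k` of the double family VANISH for `k < d`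
(`T^d ∣ ((1+T)^N − 1)^d`). [cite: Koblitz1984, Ch. IV §1] -/
theorem subst_family_eq_zero_of_lt (Q : PowerSeries (PadicComplexInt p)) (N : ℕ) (x : ℂ_[p])
    {d k : ℕ} (h : k < d) :
    ((PowerSeries.coeff d Q : PadicComplexInt p) : ℂ_[p]) *
      (((PowerSeries.coeff k ((((1 : PowerSeries (PadicComplexInt p)) + X) ^ N - 1) ^ d) :
        PadicComplexInt p) : ℂ_[p]) * x ^ k) = 0 := by
  rw [Summit.BirchSwinnertonDyer.Rank1Residual.Additive.coeff_one_add_X_pow_sub_one_pow_eq_zero N h,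
    ZeroMemClass.coe_zero, zero_mul, mul_zero]

/-- The double family `[T^d]Q · [T^k]((1+T)^N − 1)^d · x^k` is absolutely summable for `‖x‖ < 1`
(bounded by `s^d s^k`, `s = ‖x‖^{1/2}`, on its support `d ≤ k`). [cite: Koblitz1984, Ch. IV §1] -/
theorem summable_subst_family (Q : PowerSeries (PadicComplexInt p)) (N : ℕ) {x : ℂ_[p]} (hx : ‖x‖ < 1) :
    Summable fun q : ℕ × ℕ => ((PowerSeries.coeff q.1 Q : PadicComplexInt p) : ℂ_[p]) *
      (((PowerSeries.coeff q.2 ((((1 : PowerSeries (PadicComplexInt p)) + X) ^ N - 1) ^ q.1) :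
        PadicComplexInt p) : ℂ_[p]) * x ^ q.2) := by
  set s : ℝ := Real.sqrt ‖x‖ with hs
  have hs0 : 0 ≤ s := Real.sqrt_nonneg _
  have hs1 : s < 1 := by rw [hs, Real.sqrt_lt' one_pos, one_pow]; exact hx
  have hss : s * s = ‖x‖ := Real.mul_self_sqrt (norm_nonneg x)
  have hg : Summable fun q : ℕ × ℕ => s ^ q.1 * s ^ q.2 :=
    (summable_geometric_of_lt_one hs0 hs1).mul_of_nonneg (summable_geometric_of_lt_one hs0 hs1)
      (fun _ => pow_nonneg hs0 _) (fun _ => pow_nonneg hs0 _)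
  refine hg.of_norm_bounded fun q => ?_
  obtain ⟨d, k⟩ := q
  dsimp only
  by_cases hdk : d ≤ k
  · have h1 : ‖((PowerSeries.coeff d Q : PadicComplexInt p) : ℂ_[p]) *
        (((PowerSeries.coeff k ((((1 : PowerSeries (PadicComplexInt p)) + X) ^ N - 1) ^ d) :
          PadicComplexInt p) : ℂ_[p]) * x ^ k)‖ ≤ ‖x‖ ^ k := by
      rw [norm_mul, norm_mul, norm_pow]
      calc ‖((PowerSeries.coeff d Q : PadicComplexInt p) : ℂ_[p])‖ *
            (‖((PowerSeries.coeff k ((((1 : PowerSeries (PadicComplexInt p)) + X) ^ N - 1) ^ d) :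
              PadicComplexInt p) : ℂ_[p])‖ * ‖x‖ ^ k)
          ≤ 1 * (1 * ‖x‖ ^ k) := by
            gcongr
            · exact norm_coe_padicComplexInt_le_one _
            · exact norm_coe_padicComplexInt_le_one _
        _ = ‖x‖ ^ k := by ring
    have h2 : ‖x‖ ^ k ≤ s ^ d * s ^ k := by
      rw [← hss, mul_pow]
      exact mul_le_mul_of_nonneg_right (pow_le_pow_of_le_one hs0 hs1.le hdk) (pow_nonneg hs0 _)
    exact h1.trans h2
  · rw [subst_family_eq_zero_of_lt Q N x (not_le.mp hdk), norm_zero]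
    exact mul_nonneg (pow_nonneg hs0 _) (pow_nonneg hs0 _)

/-- Fibre of the double family over `d`: `[T^d]Q · ((1+x)^N − 1)^d`. [cite: Koblitz1984, Ch. IV §1] -/
theorem hasSum_subst_family_fst (Q : PowerSeries (PadicComplexInt p)) (N : ℕ) (x : ℂ_[p]) (d : ℕ) :
    HasSum (fun k : ℕ => ((PowerSeries.coeff d Q : PadicComplexInt p) : ℂ_[p]) *
        (((PowerSeries.coeff k ((((1 : PowerSeries (PadicComplexInt p)) + X) ^ N - 1) ^ d) :
          PadicComplexInt p) : ℂ_[p]) * x ^ k))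
      (((PowerSeries.coeff d Q : PadicComplexInt p) : ℂ_[p]) * ((1 + x) ^ N - 1) ^ d) :=
  (hasSum_coeff_one_add_X_pow_sub_one_pow_mul_pow N d x).mul_left _

/-- Fibre of the double family over `k`: a finite sum over `d ≤ k`, equal to `[T^k](Q((1+T)^N − 1)) · x^k`
(Mathlib `PowerSeries.coeff_subst'`). [cite: Koblitz1984, Ch. IV §1] -/
theorem hasSum_subst_family_snd (Q : PowerSeries (PadicComplexInt p)) (N : ℕ) (x : ℂ_[p]) (k : ℕ) :
    HasSum (fun d : ℕ => ((PowerSeries.coeff d Q : PadicComplexInt p) : ℂ_[p]) *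
      (((PowerSeries.coeff k ((((1 : PowerSeries (PadicComplexInt p)) + X) ^ N - 1) ^ d) :
        PadicComplexInt p) : ℂ_[p]) * x ^ k))
      (((PowerSeries.coeff k (Q.subst (((1 : PowerSeries (PadicComplexInt p)) + X) ^ N - 1)) :
        PadicComplexInt p) : ℂ_[p]) * x ^ k) := by
  have hφs : HasSubst (((1 : PowerSeries (PadicComplexInt p)) + X) ^ N - 1) :=
    Summit.BirchSwinnertonDyer.Rank1Residual.Additive.hasSubst_one_add_X_pow_sub_one N
  have hfin : ∀ d ∉ Finset.range (k + 1), ((PowerSeries.coeff d Q : PadicComplexInt p) : ℂ_[p]) *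
      (((PowerSeries.coeff k ((((1 : PowerSeries (PadicComplexInt p)) + X) ^ N - 1) ^ d) :
        PadicComplexInt p) : ℂ_[p]) * x ^ k) = 0 := fun d hd => by
    rw [Finset.mem_range, not_lt] at hd
    exact subst_family_eq_zero_of_lt Q N x (Nat.lt_of_succ_le hd)
  have hsupp : (Function.support fun d : ℕ => PowerSeries.coeff d Q •
      PowerSeries.coeff k ((((1 : PowerSeries (PadicComplexInt p)) + X) ^ N - 1) ^ d)) ⊆
        ↑(Finset.range (k + 1)) := by
    intro d hd
    rw [Function.mem_support] at hd
    rw [Finset.coe_range, Set.mem_Iio]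
    by_contra hlt
    rw [not_lt] at hlt
    exact hd (by rw [Summit.BirchSwinnertonDyer.Rank1Residual.Additive.coeff_one_add_X_pow_sub_one_pow_eq_zero
      N (Nat.lt_of_succ_le hlt), smul_zero])
  have hsum : ∑ d ∈ Finset.range (k + 1), ((PowerSeries.coeff d Q : PadicComplexInt p) : ℂ_[p]) *
      (((PowerSeries.coeff k ((((1 : PowerSeries (PadicComplexInt p)) + X) ^ N - 1) ^ d) :
        PadicComplexInt p) : ℂ_[p]) * x ^ k) =
      ((PowerSeries.coeff k (Q.subst (((1 : PowerSeries (PadicComplexInt p)) + X) ^ N - 1)) :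
        PadicComplexInt p) : ℂ_[p]) * x ^ k := by
    rw [PowerSeries.coeff_subst' hφs Q k, finsum_eq_sum_of_support_subset _ hsupp,
      AddSubmonoidClass.coe_finsetSum, Finset.sum_mul]
    refine Finset.sum_congr rfl fun d _ => ?_
    rw [smul_eq_mul, MulMemClass.coe_mul, mul_assoc]
  rw [← hsum]
  exact hasSum_sum_of_ne_finset_zero hfin

/-- **Evaluation commutes with `T ↦ (1+T)^N − 1`.** For `Q ∈ 𝒪_{ℂ_p}⟦T⟧` and `‖x‖ < 1`:
`Q((1+T)^N − 1)` (Mathlib `PowerSeries.subst`) has value `v` at `x` iff `Q` has value `v` at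
`(1 + x)^N − 1` — fibrewise summation of the absolutely summable double family, over `k` (the
coefficients of the substitution) and over `d` (the value series of `Q` at `(1+x)^N − 1`).
[cite: Koblitz1984, Ch. IV §1] [cite: deShalit1987, II.4.17 (52) (p. 77)] -/
theorem hasValueAt_subst_one_add_X_pow_sub_one_iff (Q : PowerSeries (PadicComplexInt p)) (N : ℕ)
    {x : ℂ_[p]} (hx : ‖x‖ < 1) (v : ℂ_[p]) :
    IntSeries.HasValueAt (Q.subst (((1 : PowerSeries (PadicComplexInt p)) + X) ^ N - 1)) x v ↔
      IntSeries.HasValueAt Q ((1 + x) ^ N - 1) v := by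
  have hS := (summable_subst_family Q N hx).hasSum
  -- fibres over `d`: the value series of `Q` at `(1+x)^N − 1`
  have key1 : HasSum (fun d : ℕ => ((PowerSeries.coeff d Q : PadicComplexInt p) : ℂ_[p]) *
      ((1 + x) ^ N - 1) ^ d)
      (∑' q : ℕ × ℕ, ((PowerSeries.coeff q.1 Q : PadicComplexInt p) : ℂ_[p]) *
        (((PowerSeries.coeff q.2 ((((1 : PowerSeries (PadicComplexInt p)) + X) ^ N - 1) ^ q.1) :
          PadicComplexInt p) : ℂ_[p]) * x ^ q.2)) :=
    hS.prod_fiberwise (hasSum_subst_family_fst Q N x)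
  -- the same family summed in the other order
  have h2 : HasSum (fun q : ℕ × ℕ => ((PowerSeries.coeff q.2 Q : PadicComplexInt p) : ℂ_[p]) *
      (((PowerSeries.coeff q.1 ((((1 : PowerSeries (PadicComplexInt p)) + X) ^ N - 1) ^ q.2) :
        PadicComplexInt p) : ℂ_[p]) * x ^ q.1))
      (∑' q : ℕ × ℕ, ((PowerSeries.coeff q.1 Q : PadicComplexInt p) : ℂ_[p]) *
        (((PowerSeries.coeff q.2 ((((1 : PowerSeries (PadicComplexInt p)) + X) ^ N - 1) ^ q.1) :
          PadicComplexInt p) : ℂ_[p]) * x ^ q.2)) :=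
    ((Equiv.prodComm ℕ ℕ).hasSum_iff
      (f := fun q : ℕ × ℕ => ((PowerSeries.coeff q.1 Q : PadicComplexInt p) : ℂ_[p]) *
        (((PowerSeries.coeff q.2 ((((1 : PowerSeries (PadicComplexInt p)) + X) ^ N - 1) ^ q.1) :
          PadicComplexInt p) : ℂ_[p]) * x ^ q.2))).mpr hS
  -- fibres over `k`: the value series of the substitution at `x`
  have key2 : HasSum (fun k : ℕ =>
      ((PowerSeries.coeff k (Q.subst (((1 : PowerSeries (PadicComplexInt p)) + X) ^ N - 1)) :
        PadicComplexInt p) : ℂ_[p]) * x ^ k)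
      (∑' q : ℕ × ℕ, ((PowerSeries.coeff q.1 Q : PadicComplexInt p) : ℂ_[p]) *
        (((PowerSeries.coeff q.2 ((((1 : PowerSeries (PadicComplexInt p)) + X) ^ N - 1) ^ q.1) :
          PadicComplexInt p) : ℂ_[p]) * x ^ q.2)) :=
    h2.prod_fiberwise (hasSum_subst_family_snd Q N x)
  unfold IntSeries.HasValueAt
  constructor
  · intro h
    rw [h.unique key2]
    exact key1
  · intro h
    rw [h.unique key1]
    exact key2

/-- A ring map `J : ℤ_p → 𝒪_{ℂ_p}` compatible with `ℤ_p → ℚ_p → ℂ_p` IS `IntSeries.padicIntToComplexInt`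
(the «structure-compatible `J`» quantified in the tree's main-conjecture statements). [cite: Koblitz1984, Ch. III §3–§4] -/
theorem eq_padicIntToComplexInt_of_coe (J : ℤ_[p] →+* PadicComplexInt p)
    (hJ : ∀ x : ℤ_[p], ((J x : PadicComplexInt p) : ℂ_[p]) = ((x : ℚ_[p]) : ℂ_[p])) :
    J = IntSeries.padicIntToComplexInt p :=
  RingHom.ext fun x => Subtype.ext (by rw [hJ, coe_padicIntToComplexInt])

end Values

/-! ## §2. The unit twist by a `pⁿ`-th root of unity fixes `Λ(Γ^{pⁿ}) = ℤ_p⟦ω_n⟧` -/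

universe v w

variable {p : ℕ} [Fact p.Prime] {n : ℕ}

/-- `‖u(1 + x) − 1‖ < 1` for `‖u − 1‖ < 1`, `‖u‖ ≤ 1`, `‖x‖ < 1` (`= (u − 1) + u·x`). [cite: Koblitz1984, Ch. IV §1] -/
theorem norm_mul_one_add_sub_one_lt {u x : ℂ_[p]} (hu : ‖u - 1‖ < 1) (hu1 : ‖u‖ ≤ 1) (hx : ‖x‖ < 1) :
    ‖u * (1 + x) - 1‖ < 1 := by
  have h : u * (1 + x) - 1 = (u - 1) + u * x := by ring
  rw [h]
  refine (IsUltrametricDist.norm_add_le_max _ _).trans_lt (max_lt hu ?_)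
  rw [norm_mul]
  exact (mul_le_of_le_one_left (norm_nonneg _) hu1).trans_lt hx

/-- **`ι_u` fixes `Λ_n` when `u^{pⁿ} = 1`.** For `u ∈ 1 + pℤ_p` with `u^{pⁿ} = 1` and every `a ∈ Λ`,
`unitTwist (a(ω_n)) u = a(ω_n)`: both sides, mapped to `𝒪_{ℂ_p}⟦T⟧`, take at each `x` of the open disc the
value of `a` at `(u(1+x))^{pⁿ} − 1 = (1+x)^{pⁿ} − 1` (§1 + `IntSeries.hasValueAt_unitTwist_iff`), hence agree
(identity principle); `ℤ_p⟦T⟧ → 𝒪_{ℂ_p}⟦T⟧` is injective. [cite: deShalit1987, II.4.17 (52) (p. 77)]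
[cite: Washington1997, §13.2] -/
theorem unitTwist_layerHom_of_pow_eq_one {u : ℤ_[p]} (hu : ‖u - 1‖ < 1) (hun : u ^ p ^ n = 1)
    (a : IwasawaAlgebra p) : PadicIntSeries.unitTwist (layerHom p n a) u = layerHom p n a := by
  apply PowerSeries.map_injective (IntSeries.padicIntToComplexInt p) IntSeries.padicIntToComplexInt_injective
  rw [PadicIntSeries.map_padicIntToComplexInt_unitTwist _ hu, map_layerHom_eq_subst_map]
  set J := IntSeries.padicIntToComplexInt p with hJ
  set A : PowerSeries (PadicComplexInt p) := PowerSeries.map J a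
  have hu' : ‖((J u : PadicComplexInt p) : ℂ_[p]) - 1‖ < 1 := by
    rw [hJ, PadicIntSeries.norm_coe_padicIntToComplexInt_sub_one]
    exact hu
  have hupow : ((J u : PadicComplexInt p) : ℂ_[p]) ^ p ^ n = 1 := by
    rw [← SubmonoidClass.coe_pow, ← map_pow, hun, map_one, OneMemClass.coe_one]
  refine IntSeries.eq_of_forall_hasValueAt fun x hx => ?_
  set y : ℂ_[p] := (1 + x) ^ p ^ n - 1
  have hy : ‖y‖ < 1 := (CongruentShaFreeCutPadicSupplyRate.norm_one_add_pow_sub_one_le hx.le _).trans_lt hx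
  refine ⟨_, ?_, (hasValueAt_subst_one_add_X_pow_sub_one_iff A (p ^ n) hx _).2
    (IntSeries.hasValueAt_tsum A hy)⟩
  have hU : ‖((J u : PadicComplexInt p) : ℂ_[p]) * (1 + x) - 1‖ < 1 :=
    norm_mul_one_add_sub_one_lt hu' (norm_coe_padicComplexInt_le_one _) hx
  rw [IntSeries.hasValueAt_unitTwist_iff _ hu' hx, hasValueAt_subst_one_add_X_pow_sub_one_iff A (p ^ n) hU]
  have heq : (1 + (((J u : PadicComplexInt p) : ℂ_[p]) * (1 + x) - 1)) ^ p ^ n - 1 = y := by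
    rw [add_sub_cancel, mul_pow, hupow, one_mul]
  rw [heq]
  exact IntSeries.hasValueAt_tsum A hy

/-! ## §3. `p = 2`, index `2`: `ι₋₁` and `N_1(f)(ω_1) = f · ι₋₁ f` -/

/-- `‖(−1) − 1‖ = ‖2‖ < 1` in `ℤ₂`: `−1` is a principal unit. [folklore] -/
theorem norm_neg_one_sub_one_lt_two : ‖(-1 : ℤ_[2]) - 1‖ < 1 := by
  rw [show (-1 : ℤ_[2]) - 1 = -(2 : ℕ) by norm_num, norm_neg, PadicInt.norm_p]
  norm_num

/-- **`ι₋₁` fixes `Λ(Γ^{2ⁿ})` for `n ≥ 1`** (`(−1)^{2ⁿ} = 1`). [cite: Washington1997, §13.2] -/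
theorem unitTwist_neg_one_layerHom_two (hn : n ≠ 0) (a : IwasawaAlgebra 2) :
    PadicIntSeries.unitTwist (layerHom 2 n a) (-1) = layerHom 2 n a :=
  unitTwist_layerHom_of_pow_eq_one norm_neg_one_sub_one_lt_two
    ((Nat.even_pow.2 ⟨even_two, hn⟩).neg_one_pow) a

/-- **`ι₋₁(a(ω_1) + b(ω_1)·T) = a(ω_1) − (2 + T)·b(ω_1)`**: the twist `T ↦ −2 − T` in coordinates over
`Λ_1 = ℤ₂⟦ω_1⟧` (`ι₋₁` is a ring map fixing `Λ_1`, `ι₋₁ T = −2 − T`). [cite: Washington1997, §13.2] -/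
theorem unitTwist_neg_one_of_coords (a b : IwasawaAlgebra 2) :
    PadicIntSeries.unitTwist (layerHom 2 1 a + layerHom 2 1 b * X) (-1) =
      layerHom 2 1 a - (2 + X) * layerHom 2 1 b := by
  have h := norm_neg_one_sub_one_lt_two
  rw [PadicIntSeries.unitTwist_add _ _ h, PadicIntSeries.unitTwist_mul _ _ h,
    unitTwist_neg_one_layerHom_two one_ne_zero, unitTwist_neg_one_layerHom_two one_ne_zero,
    PadicIntSeries.unitTwist_X h]
  have h2 : (C ((-1 : ℤ_[2]) - 1) : IwasawaAlgebra 2) = -2 := by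
    rw [show (-1 : ℤ_[2]) - 1 = -2 by norm_num, map_neg, map_ofNat]
  rw [h2, map_neg, map_one]
  ring

end Summit.BirchSwinnertonDyer.BirchSwinnertonDyer.Theorems.PrintCf2.LayerNormCharIdeal

end
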